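import Summits.ValiantsHypothesis.ValiantsHypothesis.Theorems.KPlusLogSqLawTropicalBScaleCarriesLex

/-!
# Route «KPlusLogSqLaw», crux `TropicalB` (stmt-ValiantsHypothesis-19771) — THE SCALE-CARRY LAW:
# in a design with `c`-separated exponent scales only the LONG scale-carries of a dominant chain are charged —
# `n + 1 ≤ ((mΔ+1)·m·W(s−1) + mΔ + 1)·(1 + #{scale-carries re-classing more than c columns})`

HONEST FRAMING.  Helper toward the registered stubs `stub_tropThin` / `stub_tropFat` / `stub_tropTowerLog` of
`Cruxes/TropicalB/Lines/birth.lean` (crux `Summit.ValiantsHypothesis.ValiantsHypothesis.Theses.KPlusLogSqLaw.TropicalB`, item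
`stmt-ValiantsHypothesis-19771`, route `KPlusLogSqLaw`; cell `pub-symmetroid`, seat val-sym-trop-p1 g10, 2026-08-27;
`--supports … --as helper`).  A STRUCTURE law for dominant chains of designs whose exponents are grouped in SEPARATED SCALES; it is
empty for general exponent vectors (one scale of large spread), bounds nothing for `TropicalB` in its window and bears on neither
`WeakLifting`, the doors, `MatrixDescartes` (stmt-ValiantsHypothesis-18050) nor VP ≠ VNP.

THE SETTING.  Classes `l : Fin K` carry a SCALE `sc l < s`; the exponents satisfy `B (sc l) ≤ d l ≤ B (sc l) + Δ` for a base
`B : ℕ → ℕ` that is `c`-SEPARATED, `c·(B t + Δ) < B t'` for `t < t' < s`, `1 ≤ c` (pure lexicographic exponents: every class its own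
scale, `Δ = 0`, `c·d l < d l'`; the other extreme: ONE scale, `Δ` = the exponent spread).  Along a chain `p_0, …, p_n` of unique optima at
strictly increasing integer slopes (the hypotheses of `TropRootLawAt` without signs; consecutive terms distinct) call the step `k → k+1`
a SCALE-CARRY if some upper scale count `#{b : t ≤ sc (λ b)}` drops, and LONG if more than `c` columns change their class.

* `psi_lt_of_short`, `psi_lt_of_upper_le`, `psi_le` — the potential `Ψ = (mΔ+1)·Σ_b W (sc (λ b)) + Σ_b (d (λ b) − B (sc (λ b)))`
  (compressed weights `W`, `c·W t + 1 ≤ W t'`) rises by `≥ 1` at every step that is short OR not a scale-carry, and `Ψ ≤ R :=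
  (mΔ+1)·m·W(s−1) + mΔ`.  (Short steps: the slope rises (`sum_d_lt_of_dominant`), the fine part moves by `≤ cΔ`, so part 1's `lexStep`
  applies; non-carries: part 1's layer cake.)
* `chain_succ_le_of_longCarries` — **THE LAW**: `n + 1 ≤ (R + 1)·(1 + #{long scale-carries})` (telescoping `card_ups_le` of
  …TropicalBDisplacement); `chain_le_of_shortCarries` — no long scale-carry ⇒ `n ≤ R`.
* `chain_le_pureLex_of_shortSteps` — pure `c`-lex exponents (`c·d l < d l'` for `l < l'`), every step re-classing `≤ c` columns:
  `n ≤ m·(c+1)^(K−1)` — `O(log c)` bits per class, linear in `m`, at every format.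
SPECIAL CASES (both literal): one scale (`s = 1`, no scale-carries exist) is the DEGREE LAW `n ≤ m·(d_max − d_min)` (…ThinRanges
`chain_le_mul_spread`); every exponent value its own scale with `Δ = 0`, `c = 1`, `W t = t` is the CARRY LAW `n + 1 ≤ (m(s−1)+1)(1 + #carries)`
of …ExchangeSector (`chain_le_of_carries`; a carry re-classes ≥ 2 columns).  So the law interpolates the two general bookkeeping laws of
the tree and adds the parameter `c`: in a `c`-separated design, carries re-classing at most `c` columns are FREE at the exchange rate
`W(s−1) < (c+1)^(s−1)`.  READING (contrapositive, for the construction side): a chain longer than `(R+1)·(L+1)` in a `c`-separated design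
has more than `L` steps that re-class MORE THAN `c` columns at once while dropping an upper scale count — super-`2^{O(K)}` growth at the
tower format `m = K·⌊log₂ K⌋` of `stub_tropTowerLog` in a lexicographic design needs digit resets of unbounded LENGTH, not only
unboundedly many carries; SHIFT-THREE's `m − 1` carries have lengths `1, 2, …, m − 1` (located, seat memo CARRY-TABLE-g10).
[folklore-level potential argument; the packaging is the cell's]
-/

set_option linter.dupNamespace false
set_option autoImplicit false

namespace Summit.ValiantsHypothesis.ValiantsHypothesis.Theorems.KPlusLogSqLaw.ScaleCarries

open Summit.ValiantsHypothesis.ValiantsHypothesis.Theorems.MatrixDescartes.Negative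
open Summit.ValiantsHypothesis.ValiantsHypothesis.Theorems.LacunarySymmetroidMatrixDescartes
open Summit.ValiantsHypothesis.ValiantsHypothesis.Theorems.LacunarySymmetroidMatrixDescartes.TropicalCensus
open scoped BigOperators
open Finset

/-! ## 1. The compressed potential along a dominant chain -/

section Chain

variable {m K : ℕ}

/-- **SHORT STEP ⇒ THE POTENTIAL RISES.**  Scales `sc l < s` with `B (sc l) ≤ d l ≤ B (sc l) + Δ`, `c`-separated base `B` and
compressed weights `W` as in `lexStep`.  If `p` is the unique optimum at `θa`, `q ≠ p` the unique optimum at `θb > θa`, and at most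
`c` columns change their class from `p` to `q`, then
`Ψ p + 1 ≤ Ψ q`, where `Ψ r = (mΔ+1)·Σ_b W (sc (r.2 b)) + Σ_b (d (r.2 b) − B (sc (r.2 b)))`. [this file] -/
theorem psi_lt_of_short {s : ℕ} (c Δ : ℕ) (hc : 1 ≤ c) (sc : Fin K → ℕ) (hsc : ∀ l, sc l < s) (B W : ℕ → ℕ)
    (d : Fin K → ℕ) (hd : ∀ l, B (sc l) ≤ d l ∧ d l ≤ B (sc l) + Δ)
    (hB : ∀ t t', t < t' → t' < s → c * (B t + Δ) < B t')
    (hW : ∀ t t', t < t' → t' < s → c * W t + 1 ≤ W t')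
    (v ε : Fin m → Fin m → Fin K → ℤ) {θa θb : ℤ} (hab : θa < θb)
    {p q : Equiv.Perm (Fin m) × (Fin m → Fin K)} (hne : p ≠ q) (hp : IsDominant d v ε θa p) (hq : IsDominant d v ε θb q)
    (hshort : (univ.filter fun b => q.2 b ≠ p.2 b).card ≤ c) :
    (m * Δ + 1) * ∑ b, W (sc (p.2 b)) + ∑ b, (d (p.2 b) - B (sc (p.2 b))) + 1 ≤
      (m * Δ + 1) * ∑ b, W (sc (q.2 b)) + ∑ b, (d (q.2 b) - B (sc (q.2 b))) := by
  classical
  -- slope = base part + fine part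
  have hD : ∀ r : Fin m → Fin K, ∑ b, d (r b) = ∑ b, B (sc (r b)) + ∑ b, (d (r b) - B (sc (r b))) := by
    intro r; rw [← sum_add_distrib]; exact sum_congr rfl fun b _ => by have := (hd (r b)).1; omega
  -- fine parts are at most `mΔ` and move by at most `Δ` per changed column
  have hFle : ∀ r : Fin m → Fin K, ∑ b, (d (r b) - B (sc (r b))) ≤ m * Δ := by
    intro r
    calc ∑ b, (d (r b) - B (sc (r b))) ≤ ∑ _b : Fin m, Δ := sum_le_sum fun b _ => by have := (hd (r b)).2; omega
      _ = m * Δ := by rw [sum_const, card_univ, Fintype.card_fin, smul_eq_mul]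
  have hFstep := sum_le_sum_add_mul_card_ne p.2 q.2 (fun l => d l - B (sc l)) Δ (fun l => by have := (hd l).2; omega)
  -- the slope law
  have hslope := sum_d_lt_of_dominant d v ε hab hne hp hq
  -- base sums and potentials as profile sums
  have hGp := sum_eq_sum_card_mul (fun b => sc (p.2 b)) (fun b => hsc _) B
  have hGq := sum_eq_sum_card_mul (fun b => sc (q.2 b)) (fun b => hsc _) B
  have hΦp := sum_eq_sum_card_mul (fun b => sc (p.2 b)) (fun b => hsc _) W
  have hΦq := sum_eq_sum_card_mul (fun b => sc (q.2 b)) (fun b => hsc _) W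
  -- hypotheses of the lex step lemma
  have hsum : ∑ t ∈ range s, (univ.filter fun b => sc (p.2 b) = t).card =
      ∑ t ∈ range s, (univ.filter fun b => sc (q.2 b) = t).card := by
    rw [sum_card_fiber (fun b => sc (p.2 b)) (fun b => hsc _), sum_card_fiber (fun b => sc (q.2 b)) (fun b => hsc _)]
  have hpos : ∑ t ∈ range s, ((univ.filter fun b => sc (q.2 b) = t).card - (univ.filter fun b => sc (p.2 b) = t).card) ≤ c := by
    refine (sum_card_tsub_le_card_ne (fun b => sc (p.2 b)) (fun b => sc (q.2 b)) (fun b => hsc _)).trans ?_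
    refine le_trans (card_le_card fun b hb => ?_) hshort
    simp only [mem_filter, mem_univ, true_and, ne_eq] at hb ⊢
    intro h; exact hb (by rw [h])
  have hG : ∑ t ∈ range s, (univ.filter fun b => sc (p.2 b) = t).card * B t + 1 ≤
      ∑ t ∈ range s, (univ.filter fun b => sc (q.2 b) = t).card * B t + c * Δ := by
    rw [← hGp, ← hGq]
    have e1 := hD p.2
    have e2 := hD q.2
    have : Δ * (univ.filter fun b => q.2 b ≠ p.2 b).card ≤ c * Δ := by rw [mul_comm]; exact Nat.mul_le_mul_right _ hshort
    omega
  rcases lexStep c Δ hc B W hB hW _ _ hsum hpos hG with hneutral | hrise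
  · -- scale-neutral step: base sums agree, the fine part carries the slope increase
    have hGeq : ∑ b, B (sc (p.2 b)) = ∑ b, B (sc (q.2 b)) := by
      rw [hGp, hGq]; exact sum_congr rfl fun t ht => by rw [hneutral t ht]
    have hΦeq : ∑ b, W (sc (p.2 b)) = ∑ b, W (sc (q.2 b)) := by
      rw [hΦp, hΦq]; exact sum_congr rfl fun t ht => by rw [hneutral t ht]
    have e1 := hD p.2
    have e2 := hD q.2
    rw [hΦeq]
    omega
  · -- the compressed potential rises by ≥ 1, which outweighs any loss of the fine part
    rw [← hΦp, ← hΦq] at hrise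
    have := hFle p.2
    nlinarith [hFle q.2, Nat.zero_le (∑ b, (d (q.2 b) - B (sc (q.2 b))))]

/-- **DOMINANCE STEP ⇒ THE POTENTIAL RISES.**  Same setting; if from `p` to `q` every upper scale count weakly increases
(the step is not a scale-carry), then `Ψ p + 1 ≤ Ψ q`, whatever the number of re-classed columns. [this file] -/
theorem psi_lt_of_upper_le {s : ℕ} (c Δ : ℕ) (hc : 1 ≤ c) (sc : Fin K → ℕ) (hsc : ∀ l, sc l < s) (B W : ℕ → ℕ)
    (d : Fin K → ℕ) (hd : ∀ l, B (sc l) ≤ d l ∧ d l ≤ B (sc l) + Δ)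
    (hW : ∀ t t', t < t' → t' < s → c * W t + 1 ≤ W t')
    (v ε : Fin m → Fin m → Fin K → ℤ) {θa θb : ℤ} (hab : θa < θb)
    {p q : Equiv.Perm (Fin m) × (Fin m → Fin K)} (hne : p ≠ q) (hp : IsDominant d v ε θa p) (hq : IsDominant d v ε θb q)
    (hup : ∀ t : ℕ, (univ.filter fun b => t ≤ sc (p.2 b)).card ≤ (univ.filter fun b => t ≤ sc (q.2 b)).card) :
    (m * Δ + 1) * ∑ b, W (sc (p.2 b)) + ∑ b, (d (p.2 b) - B (sc (p.2 b))) + 1 ≤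
      (m * Δ + 1) * ∑ b, W (sc (q.2 b)) + ∑ b, (d (q.2 b) - B (sc (q.2 b))) := by
  classical
  have hD : ∀ r : Fin m → Fin K, ∑ b, d (r b) = ∑ b, B (sc (r b)) + ∑ b, (d (r b) - B (sc (r b))) := by
    intro r; rw [← sum_add_distrib]; exact sum_congr rfl fun b _ => by have := (hd (r b)).1; omega
  have hFle : ∀ r : Fin m → Fin K, ∑ b, (d (r b) - B (sc (r b))) ≤ m * Δ := by
    intro r
    calc ∑ b, (d (r b) - B (sc (r b))) ≤ ∑ _b : Fin m, Δ := sum_le_sum fun b _ => by have := (hd (r b)).2; omega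
      _ = m * Δ := by rw [sum_const, card_univ, Fintype.card_fin, smul_eq_mul]
  have hslope := sum_d_lt_of_dominant d v ε hab hne hp hq
  by_cases hN : ∀ t ∈ range s, (univ.filter fun b => sc (p.2 b) = t).card = (univ.filter fun b => sc (q.2 b) = t).card
  · -- scale-neutral: base sums and potentials agree, the fine part rises with the slope
    have hGeq : ∑ b, B (sc (p.2 b)) = ∑ b, B (sc (q.2 b)) := by
      rw [sum_eq_sum_card_mul (fun b => sc (p.2 b)) (fun b => hsc _) B,
        sum_eq_sum_card_mul (fun b => sc (q.2 b)) (fun b => hsc _) B]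
      exact sum_congr rfl fun t ht => by rw [hN t ht]
    have hΦeq : ∑ b, W (sc (p.2 b)) = ∑ b, W (sc (q.2 b)) := by
      rw [sum_eq_sum_card_mul (fun b => sc (p.2 b)) (fun b => hsc _) W,
        sum_eq_sum_card_mul (fun b => sc (q.2 b)) (fun b => hsc _) W]
      exact sum_congr rfl fun t ht => by rw [hN t ht]
    have e1 := hD p.2
    have e2 := hD q.2
    rw [hΦeq]
    omega
  · have hmono : ∀ j, j + 1 < s → W j + 1 ≤ W (j + 1) := by
      intro j hj
      have h1 := hW j (j + 1) (Nat.lt_succ_self j) hj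
      have h2 : W j ≤ c * W j := Nat.le_mul_of_pos_left _ (by omega)
      omega
    have hrise := sum_weight_lt_of_upper_le sc hsc W hmono p.2 q.2 hup hN
    have := hFle p.2
    nlinarith [hFle q.2, Nat.zero_le (∑ b, (d (q.2 b) - B (sc (q.2 b))))]

/-- the potential is bounded: `Ψ ≤ (mΔ+1)·m·W(s−1) + mΔ`. [this file] -/
theorem psi_le {s : ℕ} (c Δ : ℕ) (hc : 1 ≤ c) (sc : Fin K → ℕ) (hsc : ∀ l, sc l < s) (B W : ℕ → ℕ)
    (d : Fin K → ℕ) (hd : ∀ l, B (sc l) ≤ d l ∧ d l ≤ B (sc l) + Δ)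
    (hW : ∀ t t', t < t' → t' < s → c * W t + 1 ≤ W t') (r : Fin m → Fin K) :
    (m * Δ + 1) * ∑ b, W (sc (r b)) + ∑ b, (d (r b) - B (sc (r b))) ≤ (m * Δ + 1) * (m * W (s - 1)) + m * Δ := by
  have hWle : ∀ l, W (sc l) ≤ W (s - 1) := by
    intro l
    rcases Nat.lt_or_ge (sc l) (s - 1) with h | h
    · have h1 := hW (sc l) (s - 1) h (by have := hsc l; omega)
      have h2 : W (sc l) ≤ c * W (sc l) := Nat.le_mul_of_pos_left _ (by omega)
      omega
    · have : sc l = s - 1 := by have := hsc l; omega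
      rw [this]
  have h1 : ∑ b, W (sc (r b)) ≤ m * W (s - 1) := by
    calc ∑ b, W (sc (r b)) ≤ ∑ _b : Fin m, W (s - 1) := sum_le_sum fun b _ => hWle _
      _ = m * W (s - 1) := by rw [sum_const, card_univ, Fintype.card_fin, smul_eq_mul]
  have h2 : ∑ b, (d (r b) - B (sc (r b))) ≤ m * Δ := by
    calc ∑ b, (d (r b) - B (sc (r b))) ≤ ∑ _b : Fin m, Δ := sum_le_sum fun b _ => by have := (hd (r b)).2; omega
      _ = m * Δ := by rw [sum_const, card_univ, Fintype.card_fin, smul_eq_mul]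
  nlinarith [Nat.mul_le_mul_left (m * Δ + 1) h1]

open Classical in
/-- **THE SCALE-CARRY LAW (only LONG SCALE-CARRIES are charged).**  In a design whose classes carry `c`-separated scales
(`B (sc l) ≤ d l ≤ B (sc l) + Δ`, `c·(B t + Δ) < B t'` for `t < t' < s`, `1 ≤ c`), every chain of unique optima at strictly
increasing integer slopes with distinct consecutive terms satisfies
`n + 1 ≤ ((mΔ+1)·m·W(s−1) + mΔ + 1) · (1 + #{k : step k is a scale-carry re-classing more than c columns})`
for any compressed weights `W` (`c·W t + 1 ≤ W t'` for `t < t'`; e.g. `W t = Σ_{i<t} c^i`), where a SCALE-CARRY is a step at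
which some upper scale count `#{b : t ≤ sc (λ b)}` drops.  Non-carries and short carries are free: each raises the bounded
potential `Ψ` (`psi_lt_of_upper_le`, `psi_lt_of_short`, `psi_le`); the telescoping count `card_ups_le` (…TropicalBDisplacement)
charges each long carry at most the range of `Ψ`.  SPECIAL CASES: `s = 1` (one scale, `Δ` = exponent spread): no scale-carries
exist and the bound is the degree law `n ≤ m·Δ`; every exponent value its own scale, `Δ = 0`, `c = 1`, `W t = t`: the charged steps
are exactly the carries and the bound is `(m(s−1)+1)·(1 + #carries)` — the carry law of …ExchangeSector. [this file] -/
theorem chain_succ_le_of_longCarries {s : ℕ} (c Δ : ℕ) (hc : 1 ≤ c) (sc : Fin K → ℕ) (hsc : ∀ l, sc l < s) (B W : ℕ → ℕ)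
    (d : Fin K → ℕ) (hd : ∀ l, B (sc l) ≤ d l ∧ d l ≤ B (sc l) + Δ)
    (hB : ∀ t t', t < t' → t' < s → c * (B t + Δ) < B t')
    (hW : ∀ t t', t < t' → t' < s → c * W t + 1 ≤ W t')
    (v ε : Fin m → Fin m → Fin K → ℤ) {n : ℕ} (θ : Fin (n + 1) → ℤ)
    (p : Fin (n + 1) → Equiv.Perm (Fin m) × (Fin m → Fin K))
    (hθ : StrictMono θ) (hdom : ∀ k, IsDominant d v ε (θ k) (p k)) (hne : ∀ k : Fin n, p k.castSucc ≠ p k.succ) :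
    n + 1 ≤ ((m * Δ + 1) * (m * W (s - 1)) + m * Δ + 1) *
      ((univ.filter fun k : Fin n =>
        (¬ ∀ t : ℕ, (univ.filter fun b => t ≤ sc ((p k.castSucc).2 b)).card ≤
            (univ.filter fun b => t ≤ sc ((p k.succ).2 b)).card) ∧
        c < (univ.filter fun b => (p k.succ).2 b ≠ (p k.castSucc).2 b).card).card + 1) := by
  classical
  set Ψ : Fin (n + 1) → ℕ := fun k => (m * Δ + 1) * ∑ b, W (sc ((p k).2 b)) + ∑ b, (d ((p k).2 b) - B (sc ((p k).2 b)))
    with hΨ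
  set R := (m * Δ + 1) * (m * W (s - 1)) + m * Δ with hR
  set bad : Fin n → Prop := fun k =>
    (¬ ∀ t : ℕ, (univ.filter fun b => t ≤ sc ((p k.castSucc).2 b)).card ≤
        (univ.filter fun b => t ≤ sc ((p k.succ).2 b)).card) ∧
    c < (univ.filter fun b => (p k.succ).2 b ≠ (p k.castSucc).2 b).card with hbad
  set L := (univ.filter fun k : Fin n => bad k).card with hL
  have hups := card_ups_le Ψ R (fun k => psi_le c Δ hc sc hsc B W d hd hW (p k).2)
  -- good steps (non-carries, or short) are rises of Ψ
  have hgoodrise : ∀ k : Fin n, ¬ bad k → Ψ k.castSucc + 1 ≤ Ψ k.succ := by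
    intro k hk
    simp only [hbad, not_and_or, not_not, not_lt] at hk
    rcases hk with hup | hsh
    · exact psi_lt_of_upper_le c Δ hc sc hsc B W d hd hW v ε (hθ Fin.castSucc_lt_succ) (hne k) (hdom _) (hdom _) hup
    · exact psi_lt_of_short c Δ hc sc hsc B W d hd hB hW v ε (hθ Fin.castSucc_lt_succ) (hne k) (hdom _) (hdom _) hsh
  have hgood : (univ.filter fun k : Fin n => ¬ bad k).card ≤ (univ.filter fun k : Fin n => Ψ k.castSucc < Ψ k.succ).card := by
    refine card_le_card fun k hk => ?_
    rw [mem_filter] at hk ⊢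
    exact ⟨mem_univ _, by have := hgoodrise k hk.2; omega⟩
  -- drops of Ψ are bad steps
  have hdrop : (univ.filter fun k : Fin n => Ψ k.succ < Ψ k.castSucc).card ≤ L := by
    refine card_le_card fun k hk => ?_
    rw [mem_filter] at hk ⊢
    refine ⟨mem_univ _, ?_⟩
    by_contra hkb
    have := hgoodrise k hkb
    omega
  have hn := card_filter_add_card_filter_not (s := (univ : Finset (Fin n))) bad
  rw [card_univ, Fintype.card_fin] at hn
  have hmul : R * ((univ.filter fun k : Fin n => Ψ k.succ < Ψ k.castSucc).card + 1) ≤ R * (L + 1) :=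
    Nat.mul_le_mul_left _ (by omega)
  nlinarith [hups, hgood, hdrop, hn, hmul]

open Classical in
/-- **ALL SCALE-CARRIES SHORT ⇒ `n ≤ (mΔ+1)·m·W(s−1) + mΔ`** (in particular when every step re-classes at most `c` columns).
[this file] -/
theorem chain_le_of_shortCarries {s : ℕ} (c Δ : ℕ) (hc : 1 ≤ c) (sc : Fin K → ℕ) (hsc : ∀ l, sc l < s) (B W : ℕ → ℕ)
    (d : Fin K → ℕ) (hd : ∀ l, B (sc l) ≤ d l ∧ d l ≤ B (sc l) + Δ)
    (hB : ∀ t t', t < t' → t' < s → c * (B t + Δ) < B t')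
    (hW : ∀ t t', t < t' → t' < s → c * W t + 1 ≤ W t')
    (v ε : Fin m → Fin m → Fin K → ℤ) {n : ℕ} (θ : Fin (n + 1) → ℤ)
    (p : Fin (n + 1) → Equiv.Perm (Fin m) × (Fin m → Fin K))
    (hθ : StrictMono θ) (hdom : ∀ k, IsDominant d v ε (θ k) (p k)) (hne : ∀ k : Fin n, p k.castSucc ≠ p k.succ)
    (hshort : ∀ k : Fin n, (¬ ∀ t : ℕ, (univ.filter fun b => t ≤ sc ((p k.castSucc).2 b)).card ≤
        (univ.filter fun b => t ≤ sc ((p k.succ).2 b)).card) →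
      (univ.filter fun b => (p k.succ).2 b ≠ (p k.castSucc).2 b).card ≤ c) :
    n ≤ (m * Δ + 1) * (m * W (s - 1)) + m * Δ := by
  classical
  have h := chain_succ_le_of_longCarries c Δ hc sc hsc B W d hd hB hW v ε θ p hθ hdom hne
  have h0 : (univ.filter fun k : Fin n =>
      (¬ ∀ t : ℕ, (univ.filter fun b => t ≤ sc ((p k.castSucc).2 b)).card ≤
          (univ.filter fun b => t ≤ sc ((p k.succ).2 b)).card) ∧
      c < (univ.filter fun b => (p k.succ).2 b ≠ (p k.castSucc).2 b).card).card = 0 := by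
    rw [card_eq_zero, filter_eq_empty_iff]
    intro k _ hk
    exact absurd (hshort k hk.1) (not_le.mpr hk.2)
  rw [h0] at h
  omega

end Chain



/-! ## 2. The pure lexicographic corollary -/

variable {m K : ℕ} in
/-- **PURE `c`-LEX COROLLARY.**  If the exponents are `c`-lacunary when sorted by class index (`c·d l < d l'` for `l < l'`,
`1 ≤ c`) then every chain of unique optima at strictly increasing integer slopes with distinct consecutive terms whose steps each
re-class at most `c` columns has `n ≤ m·Σ_{i<K−1} c^i ≤ m·(c+1)^(K−1)`: `O(log c)` bits per class, linear in `m`.  (Classes may be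
relabelled to sort the exponents — …TropicalBRelabel; equal exponents are excluded by `c ≥ 1`.) [this file] -/
theorem chain_le_pureLex_of_shortSteps (c : ℕ) (hc : 1 ≤ c) (d : Fin K → ℕ)
    (hlex : ∀ l l' : Fin K, l < l' → c * d l < d l')
    (v ε : Fin m → Fin m → Fin K → ℤ) {n : ℕ} (θ : Fin (n + 1) → ℤ)
    (p : Fin (n + 1) → Equiv.Perm (Fin m) × (Fin m → Fin K))
    (hθ : StrictMono θ) (hdom : ∀ k, IsDominant d v ε (θ k) (p k)) (hne : ∀ k : Fin n, p k.castSucc ≠ p k.succ)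
    (hshort : ∀ k : Fin n, (univ.filter fun b => (p k.succ).2 b ≠ (p k.castSucc).2 b).card ≤ c) :
    n ≤ m * (c + 1) ^ (K - 1) := by
  classical
  -- scales = classes, base = exponents, spread 0
  set B : ℕ → ℕ := fun t => if h : t < K then d ⟨t, h⟩ else 0 with hBdef
  have hd : ∀ l : Fin K, B l ≤ d l ∧ d l ≤ B l + 0 := by
    intro l; simp [hBdef, l.isLt]
  have hB : ∀ t t', t < t' → t' < K → c * (B t + 0) < B t' := by
    intro t t' htt' ht'
    have ht : t < K := htt'.trans ht'
    simp only [hBdef, ht, ht', dif_pos, add_zero]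
    exact hlex ⟨t, ht⟩ ⟨t', ht'⟩ (Fin.mk_lt_mk.mpr htt')
  have h := chain_le_of_shortCarries c 0 hc (fun l : Fin K => (l : ℕ)) (fun l => l.isLt) B (fun t => ∑ i ∈ range t, c ^ i)
    d hd hB (fun t t' htt' _ => geom_compressed c t t' htt') v ε θ p hθ hdom hne (fun k _ => hshort k)
  simp only [mul_zero, zero_add, one_mul, add_zero] at h
  exact h.trans (Nat.mul_le_mul_left m (geom_le_pow c hc (K - 1)))

end Summit.ValiantsHypothesis.ValiantsHypothesis.Theorems.KPlusLogSqLaw.ScaleCarries
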